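import Summits.ABC.IUTFork.Thm311RealInd1StripTwistJWKit
import HarnessLib

/-!
# [IUTchIII] Thm 3.11 (i) (Ind1) at `v ∈ 𝕍^non`: THE equivariant lift transports a PRODUCT action on the abelianised Jannsen–Wingberg
# generators to the units — `[φ(x_c)] = Π_r [x_r]^{A_{rc}}` gives `liftUnits φ (u_c) = Π_r u_r^{A_{rc}}` and `log(liftUnits φ u_c) = Σ_r A_{rc}·log u_r`

PROOF-ONLY kit file (abc-iut cell, Cor. 3.12 sub-crew, seat abc-iut-c312-1 = holder of record of the typed [IUTchIII] Thm. 3.11, gen 14; row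
«R18 JW-MAPPING-CLASS-IMAGE», part c-0: the group → units → logarithm step that the consumer of the new named fact
`Literature.AnabelianGeometry.AbsoluteAnabelian.JannsenWingbergMappingClass` (v4 of `MLFGaloisJannsenWingbergTwists`, filed p520570, in review)
needs; it depends on NO named fact).  TAKES NO SIDE on [IUTchIII] Cor. 3.12.

Gen 11's kit (`Thm311RealInd1StripTwistJWKit`, p492652) proved `liftUnits_eq_of_theta`: if `[x] = θ(u)` and `[φ(x)] = θ(u')` in `G_v^{ab}` (THE local
reciprocity map `θ` of the tree), then THE equivariant lift of `φ ∈ Aut_top(G_v)` to `𝒪_v^×` ([AbsTopIII] Prop. 3.2 (iv); this lineage's R9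
`Real.liftUnits`) sends `u ↦ u'` — and used it for ONE multiplication (`x_b ↦ x_b x_a` ⟹ `u_b ↦ u_b u_a`, the Dehn twists).  The mapping-class-group
image of Kondo 2025 §3 (Thm. 3.17 / Rem. 3.18: every `A ∈ Sp_{2g}(ℤ)` is the abelianised plane action of some automorphism of `G_k`) acts by an
arbitrary integer matrix on the abelianised generators, so the consumer needs the PRODUCT form:
* **`liftUnits_eq_prod_zpow_of_theta`** — for a finite family `x_r ∈ G_v`, `w_r ∈ 𝒪_v^×` with `[x_r] = θ(w_r)`, an automorphism `φ` and an index `c`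
  with `[φ(x_c)] = Π_r [x_r]^{A_{rc}}`: `liftUnits v φ (w_c) = Π_r w_r^{A_{rc}}` (`θ` is a homomorphism, injective on units);
* **`of_galoisLog_liftUnits_eq_sum_of_theta`** — hence, through the Galois logarithm read in abc-iut-S7's rescaled completion,
  `log(liftUnits v φ (w_c)) = Σ_r A_{rc}·log(w_r)`: the lift acts on the logarithms of the generators by the (transposed) matrix `A` — the
  hypothesis `hT` of gen 11's `of_galoisLog_liftUnits_eq_of_generators` / `liftActsOnUnitLogAs_of_generators` for the linear map with matrix `A`.
Classical bookkeeping; [cite: MochizukiAbsAnab2004, Prop 1.2.1 (iii) p.11] (the lift is `θ⁻¹ ∘ φ^{ab} ∘ θ` on units);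
[cite: Kondo2025OuterAutMLF, §3 Rem 3.18 p.19] for what it is FOR; [claim: Mochizuki2012, status: disputed] for the (Ind1) locution.  typed ≠ proved.
-/

set_option autoImplicit false

noncomputable section

open Metric Set
open scoped Pointwise

namespace Summit.ABC.IUTFork.Thm311.Real

open NumberField IsDedekindDomain Literature.NumberTheory.NumberFields Literature.IUT.LogVolume
open Literature.NumberTheory.GaloisRepresentations
open Literature.AnabelianGeometry.AbsoluteAnabelian Literature.IUT.HodgeArakelov
open Literature.IUT.HodgeArakelov.AbsTopMonoids

variable {F : Type} [Field F] [NumberField F] (v : HeightOneSpectrum (𝓞 F))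

/-- **THE LIFT TRANSPORTS A PRODUCT ACTION ON THE ABELIANISED GENERATORS.**  Let `x : ι → G_v` and `w : ι → 𝒪_v^×` (finite `ι`) with
`[x_r] = θ(w_r)` in `G_v^{ab}` for all `r`, let `φ ∈ Aut_top(G_v)`, `A : ι → ι → ℤ`, and `c ∈ ι` with `[φ(x_c)] = Π_r [x_r]^{A r c}`.  Then
`liftUnits v φ (w_c) = Π_r (w_r)^{A r c}` (gen 11's `liftUnits_eq_of_theta`, `θ` multiplicative).
[cite: MochizukiAbsAnab2004, Prop 1.2.1 (iii) p.11] [cite: Kondo2025OuterAutMLF, §3 Rem 3.18 p.19] -/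
theorem liftUnits_eq_prod_zpow_of_theta {ι : Type} [Fintype ι] (φ : Gal v ≃ₜ* Gal v)
    (x : ι → Gal v) (w : ι → (↥(v.adicCompletionIntegers F))ˣ)
    (hθ : haveI : ValuativeExtension (v.adicCompletion F) (v.adicCompletion F) := ⟨fun _ _ => Iff.rfl⟩
      ∀ r, absGaloisAbProj (v.adicCompletion F) (x r) =
        (LocalWeilDatum.isReciprocitySystemE (F := v.adicCompletion F) (E := v.adicCompletion F)
          (LocalWeilDatum.isClassFieldTheory_localWeilDatum (v.adicCompletion F))).theta (unitsToK v (w r)))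
    (A : ι → ι → ℤ) (c : ι)
    (hφ : absGaloisAbProj (v.adicCompletion F) (φ (x c)) = ∏ r, absGaloisAbProj (v.adicCompletion F) (x r) ^ A r c) :
    liftUnits v φ (w c) = ∏ r, w r ^ A r c := by
  haveI : ValuativeExtension (v.adicCompletion F) (v.adicCompletion F) := ⟨fun _ _ => Iff.rfl⟩
  refine liftUnits_eq_of_theta v φ (hθ c) (hφ.trans ?_)
  rw [map_prod (unitsToK v), map_prod]
  refine Finset.prod_congr rfl fun r _ => ?_
  rw [map_zpow, map_zpow, hθ r]

variable (p : ℕ) [hp : Fact p.Prime] (hv : ((p : ℕ) : 𝓞 F) ∈ v.asIdeal)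

/-- **… hence on logarithms: `log(liftUnits v φ (w_c)) = Σ_r A_{rc}·log(w_r)`** (read in the rescaled completion `K_v^{(1/n_v)}`; the Galois
logarithm is additive on `𝒪_v^×`).  This is the generator hypothesis `hT` of gen 11's `of_galoisLog_liftUnits_eq_of_generators` for the
`ℚ_p`-linear map acting on the logarithms `log(w_r)` by the matrix `A`. [cite: Kondo2025OuterAutMLF, §3 Rem 3.18 p.19]
[cite: MochizukiAbsAnab2004, Prop 1.2.1 (iii) p.11] -/
theorem of_galoisLog_liftUnits_eq_sum_of_theta {ι : Type} [Fintype ι] (φ : Gal v ≃ₜ* Gal v)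
    (x : ι → Gal v) (w : ι → (↥(v.adicCompletionIntegers F))ˣ)
    (hθ : haveI : ValuativeExtension (v.adicCompletion F) (v.adicCompletion F) := ⟨fun _ _ => Iff.rfl⟩
      ∀ r, absGaloisAbProj (v.adicCompletion F) (x r) =
        (LocalWeilDatum.isReciprocitySystemE (F := v.adicCompletion F) (E := v.adicCompletion F)
          (LocalWeilDatum.isClassFieldTheory_localWeilDatum (v.adicCompletion F))).theta (unitsToK v (w r)))
    (A : ι → ι → ℤ) (c : ι)
    (hφ : absGaloisAbProj (v.adicCompletion F) (φ (x c)) = ∏ r, absGaloisAbProj (v.adicCompletion F) (x r) ^ A r c) :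
    RescaledCompletion.of F p v hv (galoisLog v (Additive.ofMul (liftUnits v φ (w c)))) =
      ∑ r, (A r c : ℚ_[p]) • RescaledCompletion.of F p v hv (galoisLog v (Additive.ofMul (w r))) := by
  rw [liftUnits_eq_prod_zpow_of_theta v φ x w hθ A c hφ, ofMul_prod, map_sum, map_sum]
  refine Finset.sum_congr rfl fun r _ => ?_
  rw [ofMul_zpow, map_zsmul, map_zsmul, Int.cast_smul_eq_zsmul]

end Summit.ABC.IUTFork.Thm311.Real

end
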